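import Literature.NumberTheory.Automorphic.HermitianLatticesAdaptedPlane
import Literature.NumberTheory.Automorphic.UnitaryLatticeTreeUnimodularFrame
import HarnessLib

/-!
# The hyperbolic plane adapted to two unimodular Hermitian lattices — ANY uniformiser
# (the unramified AND the tamely ramified quadratic case; Jacobowitz 1962 §§4–5, §§7–8; O'Meara §82F)

Topic `NumberTheory/Automorphic`; namespace `Literature.NumberTheory.Automorphic.HermitianLattice`.
THEOREMS only; no definition, no instance, no notation, no named fact, no `sorry`.  Sequel of ★
`HermitianLatticesAdaptedPlane`.

**The point.**  ★ `UnramifiedLocalConjDatum.exists_adapted_hyperbolicPair` (and the whole lattice road to the Cartan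
decomposition of the quasi-split unitary group `U(σ, J₀)`, ★ `HyperspecialUnitaryCartanFrames` ∕ `HyperspecialUnitaryCartan`)
is stated under ★ `UnramifiedLocalConjDatum σ ϖ`, whose field `σ ϖ = ϖ` (a `σ`-FIXED uniformiser) restricts it to the
UNRAMIFIED quadratic situation `K = E_w`, `w` inert.  Reading the proof, `σ ϖ = ϖ` is used only as bookkeeping
(`σ (ϖ^a) = ϖ^a` when a scalar is moved across the sesquilinear form); what the argument needs is `v (σ ϖ^a) = v (ϖ^a)`,
i.e. that `σ` preserves the valuation.  Here the theorem is re-proved under the FIVE BARE HYPOTHESES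

* `hσ : ∀ x, σ (σ x) = x`, `hvσ : ∀ x, v (σ x) = v x` (an isometric involution),
* `hϖ : v ϖ = exp (-1)` (`ϖ` ANY uniformiser of `K` — `σ ϖ` is then another one),
* (trace) `htrace : ∃ t, v t ≤ 1 ∧ t + σ t = 1` and (norm) `hnorm : ∀ u, σ u = u → v (u - 1) < 1 → ∃ z, z · σ z = u ∧
  v (z - 1) ≤ v (u - 1)`,

which hold (a) at every unramified place (they are fields of ★ `UnramifiedLocalConjDatum`;
`exists_adapted_hyperbolicPair_of_unramifiedLocalConjDatum` records the specialisation) and (b) at every TAMELY RAMIFIED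
place of a quadratic extension `E/F` of non-archimedean local fields, `σ` the conjugation (`t = ½` since `2 ∈ 𝒪ˣ`; a
`σ`-fixed `1`-unit `u` lies in `F` and is the square `s²` of its `σ`-fixed Hensel root, `s · σ s = u`,
`v (s - 1) = v (u - 1)`), and (trace) fails at the wildly ramified ones (`Tr_{E/F} 𝒪_E ⊆ 𝔭_F`).  So this is the
adapted-plane step of the lattice proof of the Cartan decomposition `U(σ, J₀)(E_w) = K₀ · T⁺ · K₀`, `K₀ = U ∩ GL_N(𝒪)`,
at the unramified and the tamely ramified places alike (files `QuasiSplitUnitaryCartanFramesTame`,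
`QuasiSplitUnitaryCartanTame`).

* the norm equation `c + α + σ α + q α σ(α) = 0` (`σ c = c ∈ 𝔪`, `σ q = q ∈ 𝒪`) is ★
  `UnitaryLatticeTree.exists_isotropic_coeff_of_trace_of_norm` ((trace) + (norm) only; imported, not restated).
* **`exists_adapted_hyperbolicPair_of_trace_norm`** — for unimodular lattices `L, M` in the same space `W` with
  `M ⊄ L` there are `a ≥ 1` and a hyperbolic pair `x, y ∈ L` with `ϖ^{-a} x ∈ M`, `ϖ^{a} y ∈ M` (conclusion
  byte-identical to the ★ unramified statement).  Proof = the ★ one with the three `σ ϖ = ϖ` spots replaced by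
  valuation estimates: `ϖ^a y₀ ∈ M` because `v (B m' (ϖ^a y₀)) = v (σ ϖ^a) · v (B m' y₀) = v (B (ϖ^a m') y₀) ≤ 1`;
  `c = B x₀ x₀ = σ(ϖ^a) ϖ^a p` has `v c ≤ v (ϖ^a)²`.

References: R. Jacobowitz, *Hermitian forms over local fields*, Amer. J. Math. 84 (1962), §§4–5 (modular lattices,
hyperbolic planes), §7 (unramified dyadic), §8 (ramified non-dyadic) [Jacobowitz1962]; O. T. O'Meara, *Introduction to
Quadratic Forms* (1963), §82F [Omeara1963]; J.-P. Serre, *Local Fields*, GTM 67 (1979), Ch. V §2 Prop. 3, Ch. III §3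
(tame ⇔ surjective trace on integers) [Serre1979]; J. Tits, *Reductive groups over local fields*, PSPUM 33.1 (1979),
§3.3.3 (Cartan decomposition for a special `K`) [Tits1979].
-/

noncomputable section

open scoped Valued WithZero

namespace Literature.NumberTheory.Automorphic.HermitianLattice

variable {K : Type*} [Field K] [Valued K ℤᵐ⁰] {σ : K →+* K} {ϖ : K}

/-! ## The adapted hyperbolic plane for any uniformiser -/

section Adapted

variable {V : Type*} [AddCommGroup V] [Module K V] {B : V →ₛₗ[σ] V →ₗ[K] K}

/-- **Adapted hyperbolic plane — any uniformiser, (trace) + (norm)** (the unramified and the tamely ramified quadratic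
case alike).  Let `L, M` be unimodular lattices in the same space `W` with `M ⊄ L`.  Then there are `a ≥ 1` and a
hyperbolic pair `x, y ∈ L` (`B x x = B y y = 0`, `B x y = 1`) with `ϖ^{-a} x ∈ M` and `ϖ^{a} y ∈ M`.  Proof = ★
`UnramifiedLocalConjDatum.exists_adapted_hyperbolicPair` (`m ∈ M` of maximal level `a`, `x₀ = ϖ^a m ∈ L` primitive,
partner `y₀ ∈ L`; exact isotropy `x = x₀ + α y₀`, `α` from ★ `UnitaryLatticeTree.exists_isotropic_coeff_of_trace_of_norm`; `y = u⁻¹ (y₀ + β x)`,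
`u = 1 + σ(α) q`, `β = -q t / σ(u)`), with `σ ϖ^a = ϖ^a` replaced by `v (σ ϖ^a) = v (ϖ^a)` in the two places it was used
(`ϖ^a y₀ ∈ M`; `v (B x₀ x₀) ≤ v (ϖ^a)²`). [cite: Jacobowitz1962, §§4–5, §7, §8] [cite: Omeara1963, §82F] -/
theorem exists_adapted_hyperbolicPair_of_trace_norm {W : Submodule K V} {L M : Submodule 𝒪[K] V}
    (hσ : ∀ x, σ (σ x) = x) (hvσ : ∀ x, Valued.v (σ x) = Valued.v x) (hϖ : Valued.v ϖ = WithZero.exp (-1 : ℤ))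
    (htrace : ∃ t : K, Valued.v t ≤ 1 ∧ t + σ t = 1)
    (hnorm : ∀ u : K, σ u = u → Valued.v (u - 1) < 1 → ∃ z : K, z * σ z = u ∧ Valued.v (z - 1) ≤ Valued.v (u - 1))
    (hB : IsHermitianForm B) (hL : IsUnimodularLattice B W L) (hM : IsUnimodularLattice B W M) (h : ¬ M ≤ L) :
    ∃ (a : ℕ) (x y : V), 1 ≤ a ∧ IsHyperbolicPair B x y ∧ x ∈ L ∧ y ∈ L ∧
      (ϖ ^ a)⁻¹ • x ∈ M ∧ (ϖ ^ a) • y ∈ M := by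
  obtain ⟨a, ha1, haM, m, hm, hprim⟩ := hL.exists_primitive_of_not_le' hϖ hM h
  have hϖ0 : ϖ ≠ 0 := fun h0 => by
    rw [h0, map_zero] at hϖ
    exact WithZero.coe_ne_zero hϖ.symm
  -- the scalar `P = ϖ^a ∈ 𝔪` (made opaque); `v (σ P) = v P`
  have hvP1 : Valued.v (ϖ ^ a) < 1 := by
    rw [map_pow]
    exact pow_lt_one₀ zero_le (by rw [hϖ, ← WithZero.exp_zero, WithZero.exp_lt_exp]; norm_num) (by omega)
  have hP0 : ϖ ^ a ≠ 0 := pow_ne_zero _ hϖ0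
  have hvσP : Valued.v (σ (ϖ ^ a)) = Valued.v (ϖ ^ a) := hvσ _
  obtain ⟨P, hPdef⟩ : ∃ P : K, ϖ ^ a = P := ⟨_, rfl⟩
  rw [hPdef] at hvP1 hP0 hprim hvσP
  simp only [hPdef] at haM
  -- the trace element `t + σ t = 1`
  obtain ⟨t, hvt, htt⟩ := htrace
  -- `x₀ := P • m ∈ L` primitive, partner `y₀`
  obtain ⟨x₀, hx₀def⟩ : ∃ x₀ : V, P • m = x₀ := ⟨_, rfl⟩
  have hx₀ : x₀ ∈ L := hx₀def ▸ haM m hm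
  rw [hx₀def] at hprim
  obtain ⟨y₀, hy₀, hxy⟩ := hL.exists_apply_eq_one_of_not_mem' hϖ hvσ hB hx₀ hprim
  have hyx : B y₀ x₀ = 1 := hB.eq_one_comm hxy
  -- `n := P • y₀ ∈ M` (valuation bookkeeping instead of `σ P = P`)
  have hn : P • y₀ ∈ M := by
    refine hM.dual _ (W.smul_mem _ (hL.le_span hy₀)) fun m' hm' => ?_
    have hint : Valued.v (B (P • m') y₀) ≤ 1 := hL.integral _ (haM m' hm') _ hy₀
    rw [form_smul_left, map_mul, hvσP] at hint
    rw [form_smul_right, map_mul]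
    exact hint
  -- the scalars `p = B m m`, `q = B y₀ y₀`, `c = B x₀ x₀ = σ(P) P p` (made opaque)
  obtain ⟨p, hpdef⟩ : ∃ p : K, B m m = p := ⟨_, rfl⟩
  obtain ⟨q, hqdef⟩ : ∃ q : K, B y₀ y₀ = q := ⟨_, rfl⟩
  obtain ⟨c, hcdef⟩ : ∃ c : K, B x₀ x₀ = c := ⟨_, rfl⟩
  have hvp : Valued.v p ≤ 1 := hpdef ▸ hM.integral m hm m hm
  have hvq : Valued.v q ≤ 1 := hqdef ▸ hL.integral y₀ hy₀ y₀ hy₀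
  have hσq : σ q = q := hqdef ▸ hB.apply_self y₀
  have hσc : σ c = c := hcdef ▸ hB.apply_self x₀
  have hc : c = σ P * (P * p) := by
    rw [← hcdef, ← hpdef, ← hx₀def, form_smul_left, form_smul_right]
  have hvPP : Valued.v c ≤ Valued.v (P * P) := by
    rw [hc, map_mul, map_mul, map_mul, hvσP]
    calc Valued.v P * (Valued.v P * Valued.v p) ≤ Valued.v P * (Valued.v P * 1) :=
          mul_le_mul' le_rfl (mul_le_mul' le_rfl hvp)
      _ = Valued.v P * Valued.v P := by rw [mul_one]
  have hvc : Valued.v c < 1 := by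
    refine lt_of_le_of_lt hvPP ?_
    rw [map_mul]
    calc Valued.v P * Valued.v P ≤ Valued.v P * 1 := mul_le_mul' le_rfl hvP1.le
      _ < 1 := by rw [mul_one]; exact hvP1
  -- the isotropy coefficient: `c + α + σ α + q α σ(α) = 0`, `v α ≤ v c`; `x₁ := x₀ + α y₀` is isotropic
  obtain ⟨α, hvα, hα⟩ := UnitaryLatticeTree.exists_isotropic_coeff_of_trace_of_norm ⟨t, hvt, htt⟩ hnorm hσc hσq hvq hvc
  have hvα1 : Valued.v α ≤ 1 := hvα.trans hvc.le
  obtain ⟨x₁, hx₁⟩ : ∃ x₁ : V, x₀ + α • y₀ = x₁ := ⟨_, rfl⟩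
  have hx₁L : x₁ ∈ L := hx₁ ▸ L.add_mem hx₀ (smul_mem_of_v_le L hvα1 hy₀)
  have hx₁x₁ : B x₁ x₁ = 0 := by
    have hexp : B x₁ x₁ = c + α + σ α + q * (α * σ α) := by
      rw [← hx₁]
      simp only [map_add, LinearMap.add_apply, form_smul_left B α, form_smul_right B α, hxy, hyx, hcdef, hqdef]
      ring
    rw [hexp, hα]
  -- `u := B x₁ y₀ = 1 + σ(α) q`, a unit (not necessarily `σ`-fixed)
  obtain ⟨u, hudef⟩ : ∃ u : K, 1 + σ α * q = u := ⟨_, rfl⟩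
  have hu : B x₁ y₀ = u := by
    rw [← hx₁, ← hudef, map_add, LinearMap.add_apply, form_smul_left B α, hxy, hqdef]
  have hvu : Valued.v u = 1 := by
    rw [← hudef]
    refine Valuation.map_one_add_of_lt _ ?_
    rw [map_mul, hvσ]
    calc Valued.v α * Valued.v q ≤ Valued.v c * 1 := mul_le_mul' hvα hvq
      _ < 1 := by rw [mul_one]; exact hvc
  have hu0 : u ≠ 0 := fun h0 => by rw [h0, map_zero] at hvu; exact zero_ne_one hvu
  have hσu0 : σ u ≠ 0 := (map_ne_zero σ).2 hu0
  have hvσu : Valued.v (σ u) = 1 := by rw [hvσ, hvu]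
  have hyx₁ : B y₀ x₁ = σ u := by rw [← hB x₁ y₀, hu]
  -- `β := -(q t) / σ(u)`; `y₁ := y₀ + β x₁` is isotropic with `B x₁ y₁ = u`
  obtain ⟨β, hβ⟩ : ∃ β : K, -(q * t) / σ u = β := ⟨_, rfl⟩
  have hvβ : Valued.v β ≤ 1 := by
    rw [← hβ, map_div₀, Valuation.map_neg, map_mul, hvσu, div_one]
    calc Valued.v q * Valued.v t ≤ 1 * 1 := mul_le_mul' hvq hvt
      _ = 1 := mul_one 1
  have hβu : β * σ u = -(q * t) := by rw [← hβ]; exact div_mul_cancel₀ _ hσu0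
  have hσβu : σ β * u = -(q * σ t) := by
    have hh := congrArg σ hβu
    rwa [map_mul, hσ, map_neg, map_mul, hσq] at hh
  obtain ⟨y₁, hy₁⟩ : ∃ y₁ : V, y₀ + β • x₁ = y₁ := ⟨_, rfl⟩
  have hy₁L : y₁ ∈ L := hy₁ ▸ L.add_mem hy₀ (smul_mem_of_v_le L hvβ hx₁L)
  have hy₁y₁ : B y₁ y₁ = 0 := by
    have hexp : B y₁ y₁ = q + β * σ u + σ β * u := by
      rw [← hy₁]
      simp only [map_add, LinearMap.add_apply, form_smul_left B β, form_smul_right B β, hyx₁, hu, hx₁x₁, hqdef]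
      ring
    rw [hexp, hβu, hσβu]
    linear_combination (-q) * htt
  have hx₁y₁ : B x₁ y₁ = u := by
    rw [← hy₁, map_add, form_smul_right, hu, hx₁x₁, mul_zero, add_zero]
  -- `y₂ := u⁻¹ y₁`
  have hvu' : Valued.v u⁻¹ ≤ 1 := by rw [map_inv₀, hvu, inv_one]
  have hy₂L : u⁻¹ • y₁ ∈ L := smul_mem_of_v_le L hvu' hy₁L
  have hpair : IsHyperbolicPair B x₁ (u⁻¹ • y₁) := by
    refine ⟨hx₁x₁, ?_, ?_⟩
    · rw [form_smul_left, form_smul_right, hy₁y₁, mul_zero, mul_zero]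
    · rw [form_smul_right, hx₁y₁, inv_mul_cancel₀ hu0]
  -- memberships in `M`: `α = γ P²` with `γ` integral
  have hPP0 : P * P ≠ 0 := mul_ne_zero hP0 hP0
  obtain ⟨γ, hγ⟩ : ∃ γ : K, α / (P * P) = γ := ⟨_, rfl⟩
  have hvγ : Valued.v γ ≤ 1 := by
    rw [← hγ, map_div₀, div_le_one₀ (zero_lt_iff.2 ((Valuation.ne_zero_iff _).2 hPP0))]
    exact hvα.trans hvPP
  have hPα : P⁻¹ * α = γ * P := by
    rw [← hγ]
    field_simp
  have hxM : P⁻¹ • x₁ ∈ M := by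
    have : P⁻¹ • x₁ = m + γ • (P • y₀) := by
      rw [← hx₁, smul_add, ← hx₀def, smul_smul, inv_mul_cancel₀ hP0, one_smul, smul_smul, hPα,
        smul_smul]
    rw [this]
    exact M.add_mem hm (smul_mem_of_v_le M hvγ hn)
  have hvPβP : Valued.v (P * β * P) ≤ 1 := by
    rw [map_mul, map_mul]
    calc Valued.v P * Valued.v β * Valued.v P ≤ 1 * 1 * 1 :=
          mul_le_mul' (mul_le_mul' hvP1.le hvβ) hvP1.le
      _ = 1 := by rw [mul_one, mul_one]
  have hyM : P • (u⁻¹ • y₁) ∈ M := by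
    have : P • (u⁻¹ • y₁) = u⁻¹ • (P • y₀ + (P * β * P) • (P⁻¹ • x₁)) := by
      rw [smul_comm P u⁻¹, ← hy₁, smul_add, smul_smul, smul_smul, mul_inv_cancel_right₀ hP0]
    rw [this]
    exact smul_mem_of_v_le M hvu' (M.add_mem hn (smul_mem_of_v_le M hvPβP hxM))
  refine ⟨a, x₁, u⁻¹ • y₁, ha1, hpair, hx₁L, hy₂L, ?_, ?_⟩
  · rw [hPdef]; exact hxM
  · rw [hPdef]; exact hyM

/-- The ★ unramified datum supplies the five bare hypotheses: `exists_adapted_hyperbolicPair_of_trace_norm` specialises to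
★ `UnramifiedLocalConjDatum.exists_adapted_hyperbolicPair` (same conclusion). [cite: Jacobowitz1962, §7] -/
theorem exists_adapted_hyperbolicPair_of_unramifiedLocalConjDatum {W : Submodule K V} {L M : Submodule 𝒪[K] V}
    (hd : UnramifiedLocalConjDatum σ ϖ) (hB : IsHermitianForm B)
    (hL : IsUnimodularLattice B W L) (hM : IsUnimodularLattice B W M) (h : ¬ M ≤ L) :
    ∃ (a : ℕ) (x y : V), 1 ≤ a ∧ IsHyperbolicPair B x y ∧ x ∈ L ∧ y ∈ L ∧
      (ϖ ^ a)⁻¹ • x ∈ M ∧ (ϖ ^ a) • y ∈ M :=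
  exists_adapted_hyperbolicPair_of_trace_norm hd.σσ hd.vσ hd.vϖ hd.trace hd.norm hB hL hM h

end Adapted

end Literature.NumberTheory.Automorphic.HermitianLattice

end
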